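import Mathlib
import Literature.Analysis.FluidPDE.VectorCalculus
import Literature.Analysis.FluidPDE.SelfSimilarEulerProfile
import Summits.NavierStokesRegularity.NavierStokesRegularity.Theorems.EulerZoomLiouvillePowerGaugeEulerLiouvilleCondenserGradientRiccati
import Summits.NavierStokesRegularity.NavierStokesRegularity.Theorems.EulerZoomLiouvillePowerGaugeEulerLiouvilleNeedleStagnationKinematics
import HarnessLib

/-!
# R52 §B: THE PRESSURE HESSIAN AT A VORTICAL NODE — `D(∇P)(z)·Ω = −2·Ω`
# (nsreg-p2 ROUND-52 «PROVENANCE» v1.2 bca60ece7b3dcb40, `r52/Sketch52.v1.2.lean` 60bfd4b645ab26b0 §B l.148–163 VERBATIM —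
# `NsregP2.R52.Provenance.fderiv_gradient_pressure_curl_of_stagnation` + `inner_…`; plate t55-LAWS (B); seat ns-sfl-p1 g9,
# `--supports stmt-NavierStokesRegularity-19832 --as helper`)

At a stagnation point `z` of the wind (`γz + U z = 0`, centre `0`) of a `C²` self-similar Euler profile, the vorticity `Ω(z) = curl U z`
is an eigenvector of the pressure Hessian with the UNIVERSAL eigenvalue `−2` (independent of `γ`): `D(∇P)(z) Ω(z) = −2 Ω(z)`.
Ingredients: the tree's `Condenser.fderiv_gradient_pressure_eq` (`D∇P = −((1−γ)DU + DU∘(γ·id + DU) + D²U[W])`, the last term vanishing at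
`W(z) = 0`) and `Stagnation.fderiv_apply_curl_of_stagnation` (`DU(z)Ω = Ω`): `−((1−γ)Ω + DU(γΩ + Ω)) = −((1−γ) + γ + 1)Ω = −2Ω`.

HONEST FRAMING: a class-free pointwise identity about hypothetical self-similar Euler profiles; nothing about the crux E (19832 OPEN) or NS
regularity is proved here. [cite: ConstantinIgnatovaVicol2026Putative, §3 eqs. (3.3), (3.23)] [nsreg-p2 R52 §B]
-/

noncomputable section

set_option linter.dupNamespace false

open Set Filter Topology Metric Function InnerProductSpace
open scoped RealInnerProductSpace Topology

namespace Summit.NavierStokesRegularity.NavierStokesRegularity.Theorems.PowerGaugeEulerLiouville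

open Literature.Analysis Literature.Analysis.FluidPDE

namespace Stagnation

/-- **UNIVERSAL AXIAL PRESSURE CURVATURE.**  At a stagnation point `z` of the wind (`γz + U z = 0`, centre `0`) of a `C²` self-similar Euler
profile, the vorticity `Ω(z) = curl U z` is an eigenvector of the pressure Hessian with eigenvalue `−2`, whatever `γ`:
`D(∇P)(z) Ω(z) = −2 Ω(z)`.  Proof: `D(∇P)(z) = −((1−γ)DU(z) + DU(z)∘(γ·id + DU(z)))` (tree `Condenser.fderiv_gradient_pressure_eq`, the
`D²U[W]` term vanishing at `W(z) = 0`) and `DU(z)Ω = Ω` (tree `Stagnation.fderiv_apply_curl_of_stagnation`):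
`−((1−γ)Ω + DU(γΩ + Ω)) = −((1−γ) + γ + 1)Ω = −2Ω`. (proof: nsreg-p2 g42, `r52/Sketch52.lean`, verbatim)
[nsreg-p2 R52 §B; cite: ConstantinIgnatovaVicol2026Putative, §3 eqs. (3.3), (3.23)] -/
theorem fderiv_gradient_pressure_curl_of_stagnation {γ : ℝ} {U : EuclideanSpace ℝ (Fin 3) → EuclideanSpace ℝ (Fin 3)}
    {P : EuclideanSpace ℝ (Fin 3) → ℝ}
    (hprof : IsSelfSimilarEulerProfile γ 0 U P) {z : EuclideanSpace ℝ (Fin 3)} (hz : selfSimilarTransport γ 0 U z = 0) :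
    fderiv ℝ (gradient P) z (curl U z) = (-2 : ℝ) • curl U z := by
  have hΩ := Stagnation.fderiv_apply_curl_of_stagnation hprof hz
  rw [Condenser.fderiv_gradient_pressure_eq hprof z, hz, map_zero, add_zero]
  simp only [_root_.neg_apply, _root_.add_apply, _root_.smul_apply,
    ContinuousLinearMap.comp_apply, ContinuousLinearMap.id_apply, map_add, map_smul, hΩ]
  module

/-- Scalar form: `⟪D(∇P)(z)Ω, Ω⟫ = −2‖Ω‖²` — the pressure is strictly concave ALONG THE VORTEX LINE through every vortical node, with
curvature `−2` in absolute units (so over the knot scale `T ≪ R` the axial pressure drop is `O(T²)`, negligible against the ridge height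
`½γ(1−γ)R²`). (proof: nsreg-p2 g42, verbatim) [nsreg-p2 R52 §B] -/
theorem inner_fderiv_gradient_pressure_curl_of_stagnation {γ : ℝ} {U : EuclideanSpace ℝ (Fin 3) → EuclideanSpace ℝ (Fin 3)}
    {P : EuclideanSpace ℝ (Fin 3) → ℝ}
    (hprof : IsSelfSimilarEulerProfile γ 0 U P) {z : EuclideanSpace ℝ (Fin 3)} (hz : selfSimilarTransport γ 0 U z = 0) :
    ⟪fderiv ℝ (gradient P) z (curl U z), curl U z⟫ = -2 * ‖curl U z‖ ^ 2 := by
  rw [fderiv_gradient_pressure_curl_of_stagnation hprof hz, real_inner_smul_left, real_inner_self_eq_norm_sq]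

end Stagnation

end Summit.NavierStokesRegularity.NavierStokesRegularity.Theorems.PowerGaugeEulerLiouville

end
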